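import Summits.Ventures.WeilGRH.FrontierPhaseCellsNineteenA
import Summits.Ventures.WeilGRH.FrontierPhaseCellsTwentyFiveA
import Summits.Ventures.WeilGRH.FrontierPhaseCellsTwentyNineA
import HarnessLib

/-!
# GRH arm (rh-explicit, venture WeilGRH): the `ζ` frontier below the all-`χ` threshold `30` — restricted arcs of `χ(2)`

Companions of `weilPositivityOnChar_frontier_of_ge_thirty` (`FrontierUniformThirty.lean`): the same phase-cell
transfer at the budgets `log 19`, `log 25`, `log 29`, for the characters whose value `χ(2)` stays away from `1`
(`Re χ(2) ≤ −0.14`, `≤ 0.5`, `≤ 0.8` respectively). The reduction's budget with the true phase `θ = arg χ(2)` is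
`B(θ) = 3.3977 (0°) … 2.915 (90°) … 2.686 (120°) … 2.821 (180°)`, so a modulus `q` admits exactly the arcs with
`B(θ) < log q`. These theorems turn the corresponding CERTIFIED census / A2 classes of conductor `19 … 29`
(direct `K(t)`-closure at `t = 1`, `EXTREMALS/GRH`) into tree theorems.

## References

* A. Weil (1952), (11) and the «lemme» p. 262; H. Yoshida (1992) §6.
-/

noncomputable section

open Complex Filter Set MeasureTheory
open scoped Real Topology ComplexConjugate

namespace Summit.Ventures.WeilGRH

open Literature.NumberTheory.LFunctions

variable {q : ℕ}

/-- **The `ζ` frontier `4023/5000` for every `χ` mod `q ≥ 19` with `Re χ(2) ≤ -0.14`** (i.e. `arg χ(2) ∉ (−98.05°, 98.05°)`;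
8 + 8 certified phase cells at the budget `B = 2.943052 ≤ log 19`). Below the all-`χ` threshold `30` the reduction still
reaches the characters whose `χ(2)` is far enough from `1`; e.g. the census / A2 classes 19.3 19.7 19.14 19.9, 23.7 23.4 23.3, 25.9 25.3 25.6 25.12, 27.5 27.20 27.13, 29.23 29.19 29.9 29.18 29.7 29.14 (conjugates included).
[cite: Weil1952FormulesExplicites, (11) and the «lemme» p. 262; Yoshida1992 §6] -/
theorem weilPositivityOnChar_frontier_of_ge_nineteen_of_re_two_le (hq : 19 ≤ q) (χ : DirichletCharacter ℂ q)
    (hX : (χ (2 : ZMod q)).re ≤ -0.14) : WeilPositivityOnChar χ (4023 / 5000) := by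
  by_cases h2 : χ (2 : ZMod q) = 0
  · exact weilPositivityOnChar_frontier_of_even_ge_eighteen (by omega) χ h2
  have hz : ‖χ (2 : ZMod q)‖ = 1 := DirichletCharacter.norm_apply_eq_one_of_ne_zero χ h2
  have hn : (χ (2 : ZMod q)).re ^ 2 + (χ (2 : ZMod q)).im ^ 2 = 1 := by
    have h := Complex.sq_norm (χ (2 : ZMod q))
    rw [hz, Complex.normSq_apply] at h
    nlinarith [h]
  have hx1 : (-1 : ℝ) ≤ (χ (2 : ZMod q)).re := by nlinarith [sq_nonneg ((χ (2 : ZMod q)).re + 1), sq_nonneg (χ (2 : ZMod q)).im]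
  have hx2 : (χ (2 : ZMod q)).re ≤ (-0.14) := hX.trans (by norm_num)
  rcases le_total 0 (χ (2 : ZMod q)).im with hy | hy
  · -- upper half of the arc
    rcases le_or_gt ((-0.31851) : ℝ) (χ (2 : ZMod q)).re with h0 | h0
    · exact frontierNineteen_cell_u01 hq χ hz h0 hx2 hy
    rcases le_or_gt ((-0.578397) : ℝ) (χ (2 : ZMod q)).re with h1 | h1
    · exact frontierNineteen_cell_u02 hq χ hz h1 (h0.le.trans (by norm_num)) hy
    rcases le_or_gt ((-0.759006) : ℝ) (χ (2 : ZMod q)).re with h2 | h2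
    · exact frontierNineteen_cell_u03 hq χ hz h2 (h1.le.trans (by norm_num)) hy
    rcases le_or_gt ((-0.872641) : ℝ) (χ (2 : ZMod q)).re with h3 | h3
    · exact frontierNineteen_cell_u04 hq χ hz h3 (h2.le.trans (by norm_num)) hy
    rcases le_or_gt ((-0.943063) : ℝ) (χ (2 : ZMod q)).re with h4 | h4
    · exact frontierNineteen_cell_u05 hq χ hz h4 (h3.le.trans (by norm_num)) hy
    rcases le_or_gt ((-0.983153) : ℝ) (χ (2 : ZMod q)).re with h5 | h5
    · exact frontierNineteen_cell_u06 hq χ hz h5 (h4.le.trans (by norm_num)) hy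
    rcases le_or_gt ((-0.999351) : ℝ) (χ (2 : ZMod q)).re with h6 | h6
    · exact frontierNineteen_cell_u07 hq χ hz h6 (h5.le.trans (by norm_num)) hy
    exact frontierNineteen_cell_u08 hq χ hz hx1 (h6.le.trans (by norm_num)) hy
  · -- lower half of the arc
    rcases le_or_gt ((-0.31851) : ℝ) (χ (2 : ZMod q)).re with h0 | h0
    · exact frontierNineteen_cell_l01 hq χ hz h0 hx2 hy
    rcases le_or_gt ((-0.578397) : ℝ) (χ (2 : ZMod q)).re with h1 | h1
    · exact frontierNineteen_cell_l02 hq χ hz h1 (h0.le.trans (by norm_num)) hy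
    rcases le_or_gt ((-0.759006) : ℝ) (χ (2 : ZMod q)).re with h2 | h2
    · exact frontierNineteen_cell_l03 hq χ hz h2 (h1.le.trans (by norm_num)) hy
    rcases le_or_gt ((-0.872641) : ℝ) (χ (2 : ZMod q)).re with h3 | h3
    · exact frontierNineteen_cell_l04 hq χ hz h3 (h2.le.trans (by norm_num)) hy
    rcases le_or_gt ((-0.943063) : ℝ) (χ (2 : ZMod q)).re with h4 | h4
    · exact frontierNineteen_cell_l05 hq χ hz h4 (h3.le.trans (by norm_num)) hy
    rcases le_or_gt ((-0.983153) : ℝ) (χ (2 : ZMod q)).re with h5 | h5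
    · exact frontierNineteen_cell_l06 hq χ hz h5 (h4.le.trans (by norm_num)) hy
    rcases le_or_gt ((-0.999351) : ℝ) (χ (2 : ZMod q)).re with h6 | h6
    · exact frontierNineteen_cell_l07 hq χ hz h6 (h5.le.trans (by norm_num)) hy
    exact frontierNineteen_cell_l08 hq χ hz hx1 (h6.le.trans (by norm_num)) hy

/-- **The `ζ` frontier `4023/5000` for every `χ` mod `q ≥ 25` with `Re χ(2) ≤ 0.5`** (i.e. `arg χ(2) ∉ (−60.00°, 60.00°)`;
7 + 7 certified phase cells at the budget `B = 3.218875 ≤ log 25`). Below the all-`χ` threshold `30` the reduction still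
reaches the characters whose `χ(2)` is far enough from `1`; e.g. the census / A2 classes 25.11, 27.16, 29.3 29.5 29.12.
[cite: Weil1952FormulesExplicites, (11) and the «lemme» p. 262; Yoshida1992 §6] -/
theorem weilPositivityOnChar_frontier_of_ge_twentyfive_of_re_two_le (hq : 25 ≤ q) (χ : DirichletCharacter ℂ q)
    (hX : (χ (2 : ZMod q)).re ≤ 0.5) : WeilPositivityOnChar χ (4023 / 5000) := by
  by_cases h2 : χ (2 : ZMod q) = 0
  · exact weilPositivityOnChar_frontier_of_even_ge_eighteen (by omega) χ h2
  have hz : ‖χ (2 : ZMod q)‖ = 1 := DirichletCharacter.norm_apply_eq_one_of_ne_zero χ h2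
  have hn : (χ (2 : ZMod q)).re ^ 2 + (χ (2 : ZMod q)).im ^ 2 = 1 := by
    have h := Complex.sq_norm (χ (2 : ZMod q))
    rw [hz, Complex.normSq_apply] at h
    nlinarith [h]
  have hx1 : (-1 : ℝ) ≤ (χ (2 : ZMod q)).re := by nlinarith [sq_nonneg ((χ (2 : ZMod q)).re + 1), sq_nonneg (χ (2 : ZMod q)).im]
  have hx2 : (χ (2 : ZMod q)).re ≤ 0.5 := hX.trans (by norm_num)
  rcases le_total 0 (χ (2 : ZMod q)).im with hy | hy
  · -- upper half of the arc
    rcases le_or_gt (0.419458 : ℝ) (χ (2 : ZMod q)).re with h0 | h0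
    · exact frontierTwentyFive_cell_u01 hq χ hz h0 hx2 hy
    rcases le_or_gt (0.275813 : ℝ) (χ (2 : ZMod q)).re with h1 | h1
    · exact frontierTwentyFive_cell_u02 hq χ hz h1 (h0.le.trans (by norm_num)) hy
    rcases le_or_gt (0 : ℝ) (χ (2 : ZMod q)).re with h2 | h2
    · exact frontierTwentyFive_cell_u03 hq χ hz h2 (h1.le.trans (by norm_num)) hy
    rcases le_or_gt ((-0.47104) : ℝ) (χ (2 : ZMod q)).re with h3 | h3
    · exact frontierTwentyFive_cell_u04 hq χ hz h3 h2.le hy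
    rcases le_or_gt ((-0.844108) : ℝ) (χ (2 : ZMod q)).re with h4 | h4
    · exact frontierTwentyFive_cell_u05 hq χ hz h4 (h3.le.trans (by norm_num)) hy
    rcases le_or_gt ((-0.993883) : ℝ) (χ (2 : ZMod q)).re with h5 | h5
    · exact frontierTwentyFive_cell_u06 hq χ hz h5 (h4.le.trans (by norm_num)) hy
    exact frontierTwentyFive_cell_u07 hq χ hz hx1 (h5.le.trans (by norm_num)) hy
  · -- lower half of the arc
    rcases le_or_gt (0.419458 : ℝ) (χ (2 : ZMod q)).re with h0 | h0
    · exact frontierTwentyFive_cell_l01 hq χ hz h0 hx2 hy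
    rcases le_or_gt (0.275813 : ℝ) (χ (2 : ZMod q)).re with h1 | h1
    · exact frontierTwentyFive_cell_l02 hq χ hz h1 (h0.le.trans (by norm_num)) hy
    rcases le_or_gt (0 : ℝ) (χ (2 : ZMod q)).re with h2 | h2
    · exact frontierTwentyFive_cell_l03 hq χ hz h2 (h1.le.trans (by norm_num)) hy
    rcases le_or_gt ((-0.47104) : ℝ) (χ (2 : ZMod q)).re with h3 | h3
    · exact frontierTwentyFive_cell_l04 hq χ hz h3 h2.le hy
    rcases le_or_gt ((-0.844108) : ℝ) (χ (2 : ZMod q)).re with h4 | h4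
    · exact frontierTwentyFive_cell_l05 hq χ hz h4 (h3.le.trans (by norm_num)) hy
    rcases le_or_gt ((-0.993883) : ℝ) (χ (2 : ZMod q)).re with h5 | h5
    · exact frontierTwentyFive_cell_l06 hq χ hz h5 (h4.le.trans (by norm_num)) hy
    exact frontierTwentyFive_cell_l07 hq χ hz hx1 (h5.le.trans (by norm_num)) hy

/-- **The `ζ` frontier `4023/5000` for every `χ` mod `q ≥ 29` with `Re χ(2) ≤ 0.8`** (i.e. `arg χ(2) ∉ (−36.87°, 36.87°)`;
8 + 8 certified phase cells at the budget `B = 3.36699 ≤ log 29`). Below the all-`χ` threshold `30` the reduction still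
reaches the characters whose `χ(2)` is far enough from `1`; e.g. the census / A2 classes 29.8 29.16.
[cite: Weil1952FormulesExplicites, (11) and the «lemme» p. 262; Yoshida1992 §6] -/
theorem weilPositivityOnChar_frontier_of_ge_twentynine_of_re_two_le (hq : 29 ≤ q) (χ : DirichletCharacter ℂ q)
    (hX : (χ (2 : ZMod q)).re ≤ 0.8) : WeilPositivityOnChar χ (4023 / 5000) := by
  by_cases h2 : χ (2 : ZMod q) = 0
  · exact weilPositivityOnChar_frontier_of_even_ge_eighteen (by omega) χ h2
  have hz : ‖χ (2 : ZMod q)‖ = 1 := DirichletCharacter.norm_apply_eq_one_of_ne_zero χ h2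
  have hn : (χ (2 : ZMod q)).re ^ 2 + (χ (2 : ZMod q)).im ^ 2 = 1 := by
    have h := Complex.sq_norm (χ (2 : ZMod q))
    rw [hz, Complex.normSq_apply] at h
    nlinarith [h]
  have hx1 : (-1 : ℝ) ≤ (χ (2 : ZMod q)).re := by nlinarith [sq_nonneg ((χ (2 : ZMod q)).re + 1), sq_nonneg (χ (2 : ZMod q)).im]
  have hx2 : (χ (2 : ZMod q)).re ≤ 0.800001 := hX.trans (by norm_num)
  rcases le_total 0 (χ (2 : ZMod q)).im with hy | hy
  · -- upper half of the arc
    rcases le_or_gt (0.745378 : ℝ) (χ (2 : ZMod q)).re with h0 | h0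
    · exact frontierTwentyNine_cell_u01 hq χ hz h0 hx2 hy
    rcases le_or_gt (0.657095 : ℝ) (χ (2 : ZMod q)).re with h1 | h1
    · exact frontierTwentyNine_cell_u02 hq χ hz h1 (h0.le.trans (by norm_num)) hy
    rcases le_or_gt (0.506285 : ℝ) (χ (2 : ZMod q)).re with h2 | h2
    · exact frontierTwentyNine_cell_u03 hq χ hz h2 (h1.le.trans (by norm_num)) hy
    rcases le_or_gt (0.226625 : ℝ) (χ (2 : ZMod q)).re with h3 | h3
    · exact frontierTwentyNine_cell_u04 hq χ hz h3 (h2.le.trans (by norm_num)) hy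
    rcases le_or_gt (0 : ℝ) (χ (2 : ZMod q)).re with h4 | h4
    · exact frontierTwentyNine_cell_u05 hq χ hz h4 (h3.le.trans (by norm_num)) hy
    rcases le_or_gt ((-0.628087) : ℝ) (χ (2 : ZMod q)).re with h5 | h5
    · exact frontierTwentyNine_cell_u06 hq χ hz h5 h4.le hy
    rcases le_or_gt ((-0.961653) : ℝ) (χ (2 : ZMod q)).re with h6 | h6
    · exact frontierTwentyNine_cell_u07 hq χ hz h6 (h5.le.trans (by norm_num)) hy
    exact frontierTwentyNine_cell_u08 hq χ hz hx1 (h6.le.trans (by norm_num)) hy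
  · -- lower half of the arc
    rcases le_or_gt (0.745378 : ℝ) (χ (2 : ZMod q)).re with h0 | h0
    · exact frontierTwentyNine_cell_l01 hq χ hz h0 hx2 hy
    rcases le_or_gt (0.657095 : ℝ) (χ (2 : ZMod q)).re with h1 | h1
    · exact frontierTwentyNine_cell_l02 hq χ hz h1 (h0.le.trans (by norm_num)) hy
    rcases le_or_gt (0.506285 : ℝ) (χ (2 : ZMod q)).re with h2 | h2
    · exact frontierTwentyNine_cell_l03 hq χ hz h2 (h1.le.trans (by norm_num)) hy
    rcases le_or_gt (0.226625 : ℝ) (χ (2 : ZMod q)).re with h3 | h3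
    · exact frontierTwentyNine_cell_l04 hq χ hz h3 (h2.le.trans (by norm_num)) hy
    rcases le_or_gt (0 : ℝ) (χ (2 : ZMod q)).re with h4 | h4
    · exact frontierTwentyNine_cell_l05 hq χ hz h4 (h3.le.trans (by norm_num)) hy
    rcases le_or_gt ((-0.628087) : ℝ) (χ (2 : ZMod q)).re with h5 | h5
    · exact frontierTwentyNine_cell_l06 hq χ hz h5 h4.le hy
    rcases le_or_gt ((-0.961653) : ℝ) (χ (2 : ZMod q)).re with h6 | h6
    · exact frontierTwentyNine_cell_l07 hq χ hz h6 (h5.le.trans (by norm_num)) hy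
    exact frontierTwentyNine_cell_l08 hq χ hz hx1 (h6.le.trans (by norm_num)) hy

end Summit.Ventures.WeilGRH
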